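import Mathlib
import HarnessLib
import Summits.HubbardSuperconductivity.HubbardSuperconductivity.Theorems.KLProgrammeKLRegimeTwoVolumeLipRemeasureVar

/-!
# Route `KLProgramme` — crux K3 ENGINE (stmt-HubbardSuperconductivity-20437 `KLRegimeEngineV17F2`), stub (e) proof-input «(e)-D-ROWS»: THE (Dμ) ROW RE-BASED AT
# BLOCK 1 — the input difference of block `k ≥ 2` re-measured from the INPUT DIFFERENCE OF BLOCK 1 and the born differences of the blocks `1 ≤ k′ < k`
# (seat hubbard-kl-k3c4-p1 g25, VL lane; `--supports` 20437; DROWS-SCOPE-g25 §13.2 resolved: no block-`0` born term (N13), no `𝒱⁽⁰⁾` base (N8) — ONE base datum,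
#  the measured two-volume difference of the UV block's output `𝒱_d` at `F_{d−1}`, which is the difference tower's own block-1 array `dμ 1`)

`…LipJumpDefs.klLipInputDiff_eq_base_add_sum` writes `D_k` over `𝒱⁽⁰⁾` and ALL born terms `k′ < k`, including the UV block `k′ = 0` whose born difference has no
Lipschitz step (`1 ≤ dk` fails).  Since `𝒱_{dk} = 𝒱_d + Σ_{1≤k′<k} Δ_{k′}` and `sectorPreimage F_{dk−1} 𝒱_d = map klJump_{dk−1,d−1} (klLipInput V … d 1)`
(`sectorPreimage_eq_map_klJump`, `d ≤ dk−1` for `k ≥ 2`; the born jumps need `2 ≤ d`), the input difference of block `k ≥ 2` is the jump-transferred INPUT DIFFERENCE OF BLOCK 1 plus the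
jump-transferred born differences of the blocks `1 ≤ k′ < k`; every summand goes through the same transfer door `…LipJumpRows.klJump_transfer_le_of_scaleWtRows`.

* `klLipInputDiff_eq_base1_add_sum` — the identity (`2 ≤ d`, `2 ≤ k`);
* `lipRemeasureBase1_le_of_scaleWtRows` — the base summand through the door (defect profiles = the deep / all-pin sizes of `klLipInputDiff … d 1`, coarse profiles =
  those of `klLipInput L … d 1`);
* **`klLipInputDiffSup_le_remeasured_base1`** — the row: `klLipInputDiffSup … d k (n+1) (D₀+r) ≤ [cW₁ⁿ(cW₁·klLipInputDiffSup … d 1 (n+1) D₀ + τ₁·klLipInputDiffSup … d 1 (n+1) 0)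
  + 2cW₁ⁿτ₁N_I + n·cW₁ⁿ(5τ₁N_I + 2cW₁N_I^{far})] + Σ_{k′∈[1,k)} [block-dependent born summands as in `…LipRemeasureVar`]`.

Compositions of landed theorems; nothing asserts the (D) rows, stub (e), VL, K3 or superconductivity.
References: BGM 2006 §2.7 (2.71), §2.8 (2.76)–(2.90), §3 [cite: BenfattoGiulianiMastropietro2006]; Salmhofer 1998 §4.1.
-/

noncomputable section

namespace Summit.HubbardSuperconductivity.HubbardSuperconductivity.Theorems.TwoVolumeLip

set_option linter.dupNamespace false -- summit = problem name (single-conjunct summit), D-0017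

open Finset Literature.MathematicalPhysics.QuantumLattice GrassmannAlgebra Literature.Probability.LatticeModels
open Literature.MathematicalPhysics.QuantumLattice.FermiRG
open Summit.HubbardSuperconductivity.HubbardSuperconductivity.Theorems.KLRegimeSplit
open Summit.HubbardSuperconductivity.HubbardSuperconductivity.Theorems.KLProgrammeLegKernels
open Summit.HubbardSuperconductivity.HubbardSuperconductivity.Theorems.DispersionFlow
open Summit.HubbardSuperconductivity.HubbardSuperconductivity.Theorems.EngineV8
open Summit.HubbardSuperconductivity.HubbardSuperconductivity.Theorems.TwoVolumeSource
open Summit.HubbardSuperconductivity.HubbardSuperconductivity.Theorems.TwoVolumeDefect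

variable {L b M : ℕ} [NeZero L] [NeZero (b * L)] [NeZero M]

/-- **The input difference of block `k ≥ 2` as TRANSFERRED BLOCK-1 INPUT DIFFERENCE + RE-MEASURED BORN DIFFERENCES of the blocks `1 ≤ k′ < k`** (`2 ≤ d`):
`D_k = (map klJump′_{dk−1,d−1} (klLipInput (bL) 1) − klGlue (map klJump_{dk−1,d−1} (klLipInput L 1))) + Σ_{k′∈[1,k)} (map klJump′_{dk−1,dk′} (klLipBorn (bL) k′) −
klGlue (map klJump_{dk−1,dk′} (klLipBorn L k′)))`. -/
theorem klLipInputDiff_eq_base1_add_sum {β : ℝ} (hβ : β ≠ 0) (U μ : ℝ) (K : TrigPolyC4v) {d k : ℕ} (hd : 2 ≤ d) (hk : 2 ≤ k) :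
    klLipInputDiff L b M β U μ K d k =
      (ExteriorAlgebra.map (Matrix.toLin' (klJump (b * L) M β μ K (d * k - 1) (d * 1 - 1))) (klLipInput (b * L) M β U μ K d 1) -
          klGlue L b M (sectorCount (d * k - 1))
            (ExteriorAlgebra.map (Matrix.toLin' (klJump L M β μ K (d * k - 1) (d * 1 - 1))) (klLipInput L M β U μ K d 1))) +
        ∑ k' ∈ Ico 1 k,
          (ExteriorAlgebra.map (Matrix.toLin' (klJump (b * L) M β μ K (d * k - 1) (d * k'))) (klLipBorn (b * L) M β U μ K d k') -
            klGlue L b M (sectorCount (d * k - 1))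
              (ExteriorAlgebra.map (Matrix.toLin' (klJump L M β μ K (d * k - 1) (d * k'))) (klLipBorn L M β U μ K d k'))) := by
  have hkk : d * 2 ≤ d * k := Nat.mul_le_mul_left d hk
  have hJ1 : d * 1 - 1 + 1 ≤ d * k - 1 := by omega
  have hJ : ∀ k' ∈ Ico 1 k, d * k' + 1 ≤ d * k - 1 := by
    intro k' hk'
    have h1 : d * (k' + 1) ≤ d * k := Nat.mul_le_mul_left d (mem_Ico.1 hk').2
    rw [Nat.mul_succ] at h1
    omega
  have hinput : ∀ (V : ℕ) [NeZero V], klTowerInput V M β U μ K d k = klTowerInput V M β U μ K d 1 + ∑ k' ∈ Ico 1 k, klTowerIncr V M β U μ K d k' := by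
    intro V _
    rw [klTowerInput_eq_zero_add_sum, klTowerInput_eq_zero_add_sum, Finset.range_eq_Ico, Finset.sum_eq_sum_Ico_succ_bot (by omega : 0 < k), add_assoc]
    simp
  have hsum : ∀ (V : ℕ) [NeZero V],
      sectorPreimage β (klAnisoFamily V M β μ K klE0 (d * k - 1)) (klTowerInput V M β U μ K d k) =
        ExteriorAlgebra.map (Matrix.toLin' (klJump V M β μ K (d * k - 1) (d * 1 - 1))) (klLipInput V M β U μ K d 1) +
          ∑ k' ∈ Ico 1 k, ExteriorAlgebra.map (Matrix.toLin' (klJump V M β μ K (d * k - 1) (d * k'))) (klLipBorn V M β U μ K d k') := by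
    intro V _
    rw [hinput V, sectorPreimage_add, sectorPreimage_eq_map_smul_sectorAnalysis β _ (∑ k' ∈ Ico 1 k, _), map_sum]
    congr 1
    · rw [klLipInput_def, sectorPreimage_eq_map_klJump hβ μ K hJ1]
    · refine Finset.sum_congr rfl fun k' hk' => ?_
      rw [← sectorPreimage_eq_map_smul_sectorAnalysis, sectorPreimage_klTowerIncr_eq_map_klJump_klLipBorn hβ U μ K (hJ k' hk')]
  rw [klLipInputDiff_def, klLipInput_def, klLipInput_def, hsum (b * L), hsum L, klGlue_add, klGlue_sum, Finset.sum_sub_distrib]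
  abel

/-- **The block-1 base summand through the transfer door** (`klJump_transfer_le_of_scaleWtRows` at `W′, W := klLipInput (bL) 1, klLipInput L 1`; the defect is
`klLipInputDiff … d 1`, read at the `D₀`-deep near pins and crudely everywhere through its deep-pin sizes). -/
theorem lipRemeasureBase1_le_of_scaleWtRows {β : ℝ} (hβ : 0 < β) (U μ : ℝ) (K : TrigPolyC4v) (d k jr : ℕ)
    {ΛT cW : ℝ} (hΛT : 0 ≤ ΛT) (hΛr : ΛT ≤ klScale klE0 jr) (hcW : 0 ≤ cW)
    (hrow : ∀ x, ∑ y', ‖klJump (b * L) M β μ K (d * k - 1) (d * 1 - 1) x y'‖ *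
      klScaleWt (b * L) M β jr {latticeLegPos (2 * (2 * M)) x, latticeLegPos (2 * (2 * M)) y'} ≤ cW)
    (hcol : ∀ y', ∑ x, ‖klJump (b * L) M β μ K (d * k - 1) (d * 1 - 1) x y'‖ *
      klScaleWt (b * L) M β jr {latticeLegPos (2 * (2 * M)) x, latticeLegPos (2 * (2 * M)) y'} ≤ cW)
    {n : ℕ} (p : Fin (n + 1)) (w' : SpaceTimeIdx (b * L) M × SectorLeg (sectorCount (d * k - 1))) (D₀ r : ℕ) (hD₀ : 2 * r ≤ D₀)
    (hw : ∀ i, D₀ + r ≤ (w'.1.2 i).val % L ∧ (w'.1.2 i).val % L + (D₀ + r) < L)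
    {N Nfar : ℝ} (hN0 : 0 ≤ N) (hNfar0 : 0 ≤ Nfar)
    (hN : ∀ y, ∑ Y ∈ univ.filter (fun Y : Fin (n + 1) → SpaceTimeIdx L M × SectorLeg (sectorCount (d * 1 - 1)) => Y p = y), ‖kernel ℂ (klLipInput L M β U μ K d 1) (n + 1) Y‖ ≤ N)
    (hNfar : ∀ y (i : Fin (n + 1)),
      ∑ Y ∈ univ.filter (fun Y : Fin (n + 1) → SpaceTimeIdx L M × SectorLeg (sectorCount (d * 1 - 1)) => Y p = y ∧ r < Torus.tnorm ((Y p).1.2 - (Y i).1.2)),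
        ‖kernel ℂ (klLipInput L M β U μ K d 1) (n + 1) Y‖ ≤ Nfar) :
    ∑ X' ∈ univ.filter (fun X' : Fin (n + 1) → SpaceTimeIdx (b * L) M × SectorLeg (sectorCount (d * k - 1)) => X' p = w'),
        ‖kernel ℂ (ExteriorAlgebra.map (Matrix.toLin' (klJump (b * L) M β μ K (d * k - 1) (d * 1 - 1))) (klLipInput (b * L) M β U μ K d 1) -
            klGlue L b M (sectorCount (d * k - 1))
              (ExteriorAlgebra.map (Matrix.toLin' (klJump L M β μ K (d * k - 1) (d * 1 - 1))) (klLipInput L M β U μ K d 1))) (n + 1) X'‖ ≤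
      cW ^ n * (cW * klLipInputDiffSup L b M β U μ K d 1 (n + 1) D₀ + cW / (1 + ΛT * ((r : ℝ) + 1)) * klLipInputDiffSup L b M β U μ K d 1 (n + 1) 0) +
        (2 * cW ^ n * (cW / (1 + ΛT * ((r : ℝ) + 1))) * N + n * cW ^ n * (5 * (cW / (1 + ΛT * ((r : ℝ) + 1))) * N + 2 * cW * Nfar)) := by
  have hE0 := klLipInputDiffSup_nonneg (L := L) (b := b) (M := M) β U μ K d 1 (n + 1) D₀
  have hND0 := klLipInputDiffSup_nonneg (L := L) (b := b) (M := M) β U μ K d 1 (n + 1) 0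
  refine klJump_transfer_le_of_scaleWtRows hβ μ K (d * k - 1) (d * 1 - 1) jr hΛT hΛr hcW hrow hcol (klLipInput (b * L) M β U μ K d 1)
    (klLipInput L M β U μ K d 1) p w' D₀ r hD₀ hw hN0 hNfar0 hE0 hND0 hN hNfar (fun y' hy' => ?_) (fun y' => ?_)
  · rw [← klLipInputDiff_def]; exact sum_pinned_norm_kernel_inputDiff_le_sup_of_near β U μ K d 1 p hw y' hy'
  · rw [← klLipInputDiff_def]; exact sum_pinned_norm_kernel_inputDiff_le_sup_zero β U μ K d 1 p y'

/-- **THE (Dμ) ROW RE-BASED AT BLOCK 1** (`2 ≤ d`, `2 ≤ k`, degree `n+1`, depth `D₀ + r`, `2r ≤ D₀`; block-dependent jump rows `cW k′`, `cW₁` for the base jump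
`klJump (bL) (dk−1) (d−1)`; coarse profiles of `klLipInput L … d 1` and of the born terms `klLipBorn L … d k′`). -/
theorem klLipInputDiffSup_le_remeasured_base1 {β : ℝ} (hβ : 0 < β) (U μ : ℝ) (K : TrigPolyC4v) {d k : ℕ} (hd : 2 ≤ d) (hk : 2 ≤ k) (n D₀ r jr : ℕ)
    (hD₀ : 2 * r ≤ D₀) {ΛT : ℝ} {cW : ℕ → ℝ} {cW₁ : ℝ} (hΛT : 0 ≤ ΛT) (hΛr : ΛT ≤ klScale klE0 jr) (hcW : ∀ k', 0 ≤ cW k') (hcW₁ : 0 ≤ cW₁)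
    (hrow : ∀ k' ∈ Ico 1 k, ∀ x, ∑ y', ‖klJump (b * L) M β μ K (d * k - 1) (d * k') x y'‖ *
      klScaleWt (b * L) M β jr {latticeLegPos (2 * (2 * M)) x, latticeLegPos (2 * (2 * M)) y'} ≤ cW k')
    (hcol : ∀ k' ∈ Ico 1 k, ∀ y', ∑ x, ‖klJump (b * L) M β μ K (d * k - 1) (d * k') x y'‖ *
      klScaleWt (b * L) M β jr {latticeLegPos (2 * (2 * M)) x, latticeLegPos (2 * (2 * M)) y'} ≤ cW k')
    (hrow₁ : ∀ x, ∑ y', ‖klJump (b * L) M β μ K (d * k - 1) (d * 1 - 1) x y'‖ *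
      klScaleWt (b * L) M β jr {latticeLegPos (2 * (2 * M)) x, latticeLegPos (2 * (2 * M)) y'} ≤ cW₁)
    (hcol₁ : ∀ y', ∑ x, ‖klJump (b * L) M β μ K (d * k - 1) (d * 1 - 1) x y'‖ *
      klScaleWt (b * L) M β jr {latticeLegPos (2 * (2 * M)) x, latticeLegPos (2 * (2 * M)) y'} ≤ cW₁)
    {NI NIfar : ℝ} (hNI0 : 0 ≤ NI) (hNIfar0 : 0 ≤ NIfar)
    (hNI : ∀ (q : Fin (n + 1)) y, ∑ Y ∈ univ.filter (fun Y : Fin (n + 1) → SpaceTimeIdx L M × SectorLeg (sectorCount (d * 1 - 1)) => Y q = y),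
      ‖kernel ℂ (klLipInput L M β U μ K d 1) (n + 1) Y‖ ≤ NI)
    (hNIfar : ∀ (q : Fin (n + 1)) y (i : Fin (n + 1)),
      ∑ Y ∈ univ.filter (fun Y : Fin (n + 1) → SpaceTimeIdx L M × SectorLeg (sectorCount (d * 1 - 1)) => Y q = y ∧ r < Torus.tnorm ((Y q).1.2 - (Y i).1.2)),
        ‖kernel ℂ (klLipInput L M β U μ K d 1) (n + 1) Y‖ ≤ NIfar)
    {N Nfar : ℕ → ℝ} (hN0 : ∀ k', 0 ≤ N k') (hNfar0 : ∀ k', 0 ≤ Nfar k')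
    (hN : ∀ k' ∈ Ico 1 k, ∀ (q : Fin (n + 1)) (y : SpaceTimeIdx L M × SectorLeg (sectorCount (d * k'))),
      ∑ Y ∈ univ.filter (fun Y : Fin (n + 1) → SpaceTimeIdx L M × SectorLeg (sectorCount (d * k')) => Y q = y),
        ‖kernel ℂ (klLipBorn L M β U μ K d k') (n + 1) Y‖ ≤ N k')
    (hNfar : ∀ k' ∈ Ico 1 k, ∀ (q : Fin (n + 1)) (y : SpaceTimeIdx L M × SectorLeg (sectorCount (d * k'))) (i : Fin (n + 1)),
      ∑ Y ∈ univ.filter (fun Y : Fin (n + 1) → SpaceTimeIdx L M × SectorLeg (sectorCount (d * k')) =>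
          Y q = y ∧ r < Torus.tnorm ((Y q).1.2 - (Y i).1.2)), ‖kernel ℂ (klLipBorn L M β U μ K d k') (n + 1) Y‖ ≤ Nfar k') :
    klLipInputDiffSup L b M β U μ K d k (n + 1) (D₀ + r) ≤
      (cW₁ ^ n * (cW₁ * klLipInputDiffSup L b M β U μ K d 1 (n + 1) D₀ + cW₁ / (1 + ΛT * ((r : ℝ) + 1)) * klLipInputDiffSup L b M β U μ K d 1 (n + 1) 0) +
          (2 * cW₁ ^ n * (cW₁ / (1 + ΛT * ((r : ℝ) + 1))) * NI + n * cW₁ ^ n * (5 * (cW₁ / (1 + ΛT * ((r : ℝ) + 1))) * NI + 2 * cW₁ * NIfar))) +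
        ∑ k' ∈ Ico 1 k,
          (cW k' ^ n * (cW k' * klLipBornDiffSup L b M β U μ K d k' (n + 1) D₀ +
              cW k' / (1 + ΛT * ((r : ℝ) + 1)) * klLipBornDiffSup L b M β U μ K d k' (n + 1) 0) +
            (2 * cW k' ^ n * (cW k' / (1 + ΛT * ((r : ℝ) + 1))) * N k' +
              n * cW k' ^ n * (5 * (cW k' / (1 + ΛT * ((r : ℝ) + 1))) * N k' + 2 * cW k' * Nfar k'))) := by
  have hBD0 : ∀ k' R, 0 ≤ klLipBornDiffSup L b M β U μ K d k' (n + 1) R := fun k' R => klLipBornDiffSup_nonneg β U μ K d k' (n + 1) R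
  have hID0 : ∀ R, 0 ≤ klLipInputDiffSup L b M β U μ K d 1 (n + 1) R := fun R => klLipInputDiffSup_nonneg β U μ K d 1 (n + 1) R
  have hτ₁ : 0 ≤ cW₁ / (1 + ΛT * ((r : ℝ) + 1)) := by positivity
  have h0 : 0 ≤ (cW₁ ^ n * (cW₁ * klLipInputDiffSup L b M β U μ K d 1 (n + 1) D₀ + cW₁ / (1 + ΛT * ((r : ℝ) + 1)) * klLipInputDiffSup L b M β U μ K d 1 (n + 1) 0) +
          (2 * cW₁ ^ n * (cW₁ / (1 + ΛT * ((r : ℝ) + 1))) * NI + n * cW₁ ^ n * (5 * (cW₁ / (1 + ΛT * ((r : ℝ) + 1))) * NI + 2 * cW₁ * NIfar))) +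
        ∑ k' ∈ Ico 1 k,
          (cW k' ^ n * (cW k' * klLipBornDiffSup L b M β U μ K d k' (n + 1) D₀ +
              cW k' / (1 + ΛT * ((r : ℝ) + 1)) * klLipBornDiffSup L b M β U μ K d k' (n + 1) 0) +
            (2 * cW k' ^ n * (cW k' / (1 + ΛT * ((r : ℝ) + 1))) * N k' +
              n * cW k' ^ n * (5 * (cW k' / (1 + ΛT * ((r : ℝ) + 1))) * N k' + 2 * cW k' * Nfar k'))) := by
    have h1 := hID0 D₀; have h2 := hID0 0
    refine add_nonneg (by positivity) (sum_nonneg fun k' _ => ?_)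
    have h3 := hBD0 k' D₀; have h4 := hBD0 k' 0; have h5 := hN0 k'; have h6 := hNfar0 k'; have h7 := hcW k'
    positivity
  refine klLipInputDiffSup_le_of_forall β U μ K d k (n + 1) (D₀ + r) h0 fun q w hw => ?_
  have hw' : ∀ j, D₀ + r ≤ (w.1.2 j).val % L ∧ (w.1.2 j).val % L + (D₀ + r) < L := mem_klDeepPins.1 hw
  rw [klLipInputDiff_eq_base1_add_sum hβ.ne' U μ K hd hk]
  calc _ ≤ ∑ X ∈ univ.filter (fun X : Fin (n + 1) → SpaceTimeIdx (b * L) M × SectorLeg (sectorCount (d * k - 1)) => X q = w),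
        (‖kernel ℂ (ExteriorAlgebra.map (Matrix.toLin' (klJump (b * L) M β μ K (d * k - 1) (d * 1 - 1))) (klLipInput (b * L) M β U μ K d 1) -
            klGlue L b M (sectorCount (d * k - 1))
              (ExteriorAlgebra.map (Matrix.toLin' (klJump L M β μ K (d * k - 1) (d * 1 - 1))) (klLipInput L M β U μ K d 1))) (n + 1) X‖ +
          ∑ k' ∈ Ico 1 k,
            ‖kernel ℂ (ExteriorAlgebra.map (Matrix.toLin' (klJump (b * L) M β μ K (d * k - 1) (d * k'))) (klLipBorn (b * L) M β U μ K d k') -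
                klGlue L b M (sectorCount (d * k - 1))
                  (ExteriorAlgebra.map (Matrix.toLin' (klJump L M β μ K (d * k - 1) (d * k'))) (klLipBorn L M β U μ K d k'))) (n + 1) X‖) := by
        refine Finset.sum_le_sum fun X _ => ?_
        rw [kernel_add, kernel_sum]
        exact (norm_add_le _ _).trans (by gcongr; exact norm_sum_le _ _)
    _ ≤ _ := by
        rw [Finset.sum_add_distrib, Finset.sum_comm]
        refine add_le_add ?_ (Finset.sum_le_sum fun k' hk' => ?_)
        · exact lipRemeasureBase1_le_of_scaleWtRows hβ U μ K d k jr hΛT hΛr hcW₁ hrow₁ hcol₁ q w D₀ r hD₀ hw' hNI0 hNIfar0 (hNI q) (hNIfar q)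
        · exact lipRemeasureSummand_le_of_scaleWtRows hβ U μ K d k k' jr hΛT hΛr (hcW k') (hrow k' hk') (hcol k' hk') q w D₀ r hD₀ hw' (hN0 k') (hNfar0 k')
            (hBD0 k' D₀) (hBD0 k' 0) (hN k' hk' q) (hNfar k' hk' q) (fun y' hy' => sum_pinned_norm_kernel_bornDiff_le_sup_of_near β U μ K d k' q hw' y' hy')
            (fun y' => sum_pinned_norm_kernel_bornDiff_le_sup_zero β U μ K d k' q y')

end Summit.HubbardSuperconductivity.HubbardSuperconductivity.Theorems.TwoVolumeLip

end
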